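import Literature.AnabelianGeometry.SemiGraphs.UniversalCovering
import Literature.AnabelianGeometry.SemiGraphs.FundamentalGroupoidCountable
import Literature.AnabelianGeometry.SemiGraphs.TemperedCoverings

/-!
# The covering `𝒢_∞ → 𝒢` determined by the universal graph-covering ([SemiAnbd] §3 p. 38)

Mochizuki, *Semi-graphs of anabelioids*, §3 p. 38: "`𝒢_{∞,i} → 𝒢_i` for the covering of `𝒢_i`
determined by the universal graph-covering of the underlying semi-graph `𝔾_i` of `𝒢_i` [so
`Gal(𝒢_{∞,i}/𝒢_i) ≅ π₁(𝔾_i)`]. Thus, the `𝒢_{∞,i} → 𝒢` are tempered coverings of `𝒢` … we may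
define the tempered fundamental group `π₁^temp(𝒢) := lim_i Gal(𝒢_{∞,i}/𝒢)`."

For a countable semi-graph of anabelioids `𝒢` in the presentation of `TemperedCoverings.lean`
(`ProfiniteSemiGraph`) and a base component `c₀`, this file constructs the object
`𝒢.univCoverObj h c₀` of `B^cov(𝒢)` determined by the universal graph-covering `𝔾̃ → 𝔾`
(`UniversalCovering.lean`): over a vertex `v` the countable set of vertices of `𝔾̃` over `v` (the
hom-set `c₀ ⟶ v` of the fundamental groupoid) with the TRIVIAL action of `Π_v`, similarly over
edges, glued along a branch `b : e → v` by `p ↦ p ≫ b` — a locally trivial covering in the sense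
of Remark 3.5.1.  The deck transformations give automorphisms `deckAut γ` of this object, for
`γ ∈ π₁(𝔾, c₀)`, multiplicative in `γ` and acting freely and transitively on every fibre
(`Gal(𝒢_∞/𝒢) ⊇ π₁(𝔾)`).

Also: `BTemp.trivialObj`, the countable set with trivial action as an object of `B^temp(Π)`.
-/

namespace Literature.AnabelianGeometry.SemiGraphs

open CategoryTheory

universe u

/-- A countable set with the trivial action of `Π`, as an object of `B^temp(Π)` (all stabilisers are
the whole group, hence open). [cite: MochizukiSemiAnbd2006, §3 p.33] -/
def BTemp.trivialObj (G : Type u) [Group G] [TopologicalSpace G] (X : Type u) [Countable X] :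
    BTemp G :=
  ⟨{ V := X, ρ := 1 }, ⟨inferInstanceAs (Countable X), fun x => by
    have : {g : G | (1 : G →* End X) g x = x} = Set.univ := Set.eq_univ_of_forall fun _ => rfl
    rw [this]
    exact isOpen_univ⟩⟩

namespace ProfiniteSemiGraph

variable (𝒢 : ProfiniteSemiGraph.{u}) (h𝒢 : 𝒢.IsCountable) (c₀ : 𝒢.graph.CatCarrier)

/-- **The covering `𝒢_∞ → 𝒢` determined by the universal graph-covering of the underlying
semi-graph** (p. 38), as an object of `B^cov(𝒢)`: over `v` the vertices of `𝔾̃` over `v` (paths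
`c₀ ⟶ v` up to homotopy) with trivial `Π_v`-action, over `e` the edges of `𝔾̃` over `e`, glued
along `b : e → v` by `p ↦ p ≫ b`. [cite: MochizukiSemiAnbd2006, Prop 3.6 p.38] -/
noncomputable def univCoverObj : CovObj 𝒢 where
  SV v :=
    haveI := 𝒢.graph.countable_hom_fundamentalGroupoid h𝒢 c₀ (Sum.inl v)
    BTemp.trivialObj (𝒢.Gv v) (𝒢.graph.basept c₀ ⟶ 𝒢.graph.basept (Sum.inl v))
  SE e :=
    haveI := 𝒢.graph.countable_hom_fundamentalGroupoid h𝒢 c₀ (Sum.inr e)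
    BTemp.trivialObj (𝒢.Ge e) (𝒢.graph.basept c₀ ⟶ 𝒢.graph.basept (Sum.inr e))
  glue b v h :=
    (temperedAction (𝒢.Ge (𝒢.graph.edgeOf b))).isoMk
      (Action.mkIso (Equiv.toIso
        { toFun := fun p => p ≫ 𝒢.graph.brArrow b (𝒢.graph.edgeOf b) v rfl h
          invFun := fun q => q ≫ inv (𝒢.graph.brArrow b (𝒢.graph.edgeOf b) v rfl h)
          left_inv := fun p => by simp
          right_inv := fun q => by simp })
        (fun g => rfl))

/-- The fibre of `𝒢_∞` over `v` is the hom-set `c₀ ⟶ v` of the fundamental groupoid with the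
trivial action. [cite: MochizukiSemiAnbd2006, Prop 3.6 p.38] -/
theorem univCoverObj_ρ_V (v : 𝒢.graph.Vertex) (g : 𝒢.Gv v)
    (x : ((𝒢.univCoverObj h𝒢 c₀).SV v).obj.V) : ((𝒢.univCoverObj h𝒢 c₀).SV v).obj.ρ g x = x := rfl

/-- The fibre of `𝒢_∞` over `e` carries the trivial action. [cite: MochizukiSemiAnbd2006, Prop 3.6 p.38] -/
theorem univCoverObj_ρ_E (e : 𝒢.graph.Edge) (g : 𝒢.Ge e)
    (x : ((𝒢.univCoverObj h𝒢 c₀).SE e).obj.V) : ((𝒢.univCoverObj h𝒢 c₀).SE e).obj.ρ g x = x := rfl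

/-- The morphism of `B^cov(𝒢)` underlying the deck transformation of `γ ∈ π₁(𝔾, c₀)`:
precomposition with `γ⁻¹`. [cite: MochizukiSemiAnbd2006, Prop 3.6 p.38] -/
noncomputable def deckHom (γ : 𝒢.graph.FundamentalGroup c₀) :
    𝒢.univCoverObj h𝒢 c₀ ⟶ 𝒢.univCoverObj h𝒢 c₀ where
  fV v := ObjectProperty.homMk
    { hom := TypeCat.ofHom fun (p : 𝒢.graph.basept c₀ ⟶ 𝒢.graph.basept (Sum.inl v)) => inv γ ≫ p
      comm := fun _ => rfl }
  fE e := ObjectProperty.homMk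
    { hom := TypeCat.ofHom fun (p : 𝒢.graph.basept c₀ ⟶ 𝒢.graph.basept (Sum.inr e)) => inv γ ≫ p
      comm := fun _ => rfl }
  comm b v h := by
    apply ObjectProperty.hom_ext
    apply Action.Hom.ext
    apply ConcreteCategory.hom_ext
    intro p
    exact Category.assoc (inv γ) p (𝒢.graph.brArrow b (𝒢.graph.edgeOf b) v rfl h)

/-- `deckHom 1 = 𝟙`. [cite: MochizukiSemiAnbd2006, Prop 3.6 p.38] -/
theorem deckHom_one : 𝒢.deckHom h𝒢 c₀ 1 = 𝟙 _ := by
  have h1 : inv (𝟙 (𝒢.graph.basept c₀)) = 𝟙 _ := IsIso.inv_id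
  refine CovHom.ext (funext fun v => ?_) (funext fun e => ?_)
  · apply ObjectProperty.hom_ext
    apply Action.Hom.ext
    apply ConcreteCategory.hom_ext
    intro p
    change inv (𝟙 _) ≫ p = p
    rw [h1, Category.id_comp]
  · apply ObjectProperty.hom_ext
    apply Action.Hom.ext
    apply ConcreteCategory.hom_ext
    intro p
    change inv (𝟙 _) ≫ p = p
    rw [h1, Category.id_comp]

/-- `deckHom (γ * δ) = deckHom γ ≫ deckHom δ`. [cite: MochizukiSemiAnbd2006, Prop 3.6 p.38] -/
theorem deckHom_mul (γ δ : 𝒢.graph.FundamentalGroup c₀) :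
    𝒢.deckHom h𝒢 c₀ (γ * δ) = 𝒢.deckHom h𝒢 c₀ γ ≫ 𝒢.deckHom h𝒢 c₀ δ := by
  have hinv : inv (γ ≫ δ) = inv δ ≫ inv γ := IsIso.inv_comp
  refine CovHom.ext (funext fun v => ?_) (funext fun e => ?_)
  · apply ObjectProperty.hom_ext
    apply Action.Hom.ext
    apply ConcreteCategory.hom_ext
    intro p
    change inv (γ ≫ δ) ≫ p = inv δ ≫ (inv γ ≫ p)
    rw [hinv, Category.assoc]
  · apply ObjectProperty.hom_ext
    apply Action.Hom.ext
    apply ConcreteCategory.hom_ext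
    intro p
    change inv (γ ≫ δ) ≫ p = inv δ ≫ (inv γ ≫ p)
    rw [hinv, Category.assoc]

/-- **The deck transformation of `γ ∈ π₁(𝔾, c₀)` as an automorphism of `𝒢_∞` in `B^cov(𝒢)`**
(`Gal(𝒢_∞/𝒢) ⊇ π₁(𝔾)`). [cite: MochizukiSemiAnbd2006, Prop 3.6 p.38] -/
noncomputable def deckAut (γ : 𝒢.graph.FundamentalGroup c₀) :
    𝒢.univCoverObj h𝒢 c₀ ≅ 𝒢.univCoverObj h𝒢 c₀ where
  hom := 𝒢.deckHom h𝒢 c₀ γ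
  inv := 𝒢.deckHom h𝒢 c₀ γ⁻¹
  hom_inv_id := by rw [← deckHom_mul, mul_inv_cancel, deckHom_one]
  inv_hom_id := by rw [← deckHom_mul, inv_mul_cancel, deckHom_one]

/-- The deck automorphisms are multiplicative. [cite: MochizukiSemiAnbd2006, Prop 3.6 p.38] -/
theorem deckAut_mul (γ δ : 𝒢.graph.FundamentalGroup c₀) :
    𝒢.deckAut h𝒢 c₀ (γ * δ) = 𝒢.deckAut h𝒢 c₀ γ ≪≫ 𝒢.deckAut h𝒢 c₀ δ := by
  ext : 1
  exact 𝒢.deckHom_mul h𝒢 c₀ γ δ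

/-- The deck group acts **freely** on the fibre of `𝒢_∞` over each vertex.
[cite: MochizukiSemiAnbd2006, Prop 3.6 p.38] -/
theorem deckHom_fV_apply_eq_self_iff (γ : 𝒢.graph.FundamentalGroup c₀) (v : 𝒢.graph.Vertex)
    (p : 𝒢.graph.basept c₀ ⟶ 𝒢.graph.basept (Sum.inl v)) :
    ((𝒢.deckHom h𝒢 c₀ γ).fV v).hom.hom p = p ↔ γ = 1 := by
  change inv γ ≫ p = p ↔ γ = 1
  constructor
  · intro hp
    have : inv γ = 𝟙 _ := by
      rw [← cancel_mono p, Category.id_comp]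
      exact hp
    exact IsIso.inv_eq_inv.mp (this.trans IsIso.inv_id.symm)
  · rintro rfl
    change inv (𝟙 (𝒢.graph.basept c₀)) ≫ p = p
    rw [show inv (𝟙 (𝒢.graph.basept c₀)) = 𝟙 _ from IsIso.inv_id, Category.id_comp]

/-- The deck group acts **transitively** on the fibre of `𝒢_∞` over each vertex.
[cite: MochizukiSemiAnbd2006, Prop 3.6 p.38] -/
theorem exists_deckHom_fV_apply_eq (v : 𝒢.graph.Vertex)
    (p q : 𝒢.graph.basept c₀ ⟶ 𝒢.graph.basept (Sum.inl v)) :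
    ∃ γ : 𝒢.graph.FundamentalGroup c₀, ((𝒢.deckHom h𝒢 c₀ γ).fV v).hom.hom p = q := by
  refine ⟨p ≫ inv q, ?_⟩
  change inv (p ≫ inv q) ≫ p = q
  rw [IsIso.inv_comp, IsIso.inv_inv, Category.assoc, IsIso.inv_hom_id, Category.comp_id]

/-- The deck group acts freely on the fibre over each edge. [cite: MochizukiSemiAnbd2006, Prop 3.6 p.38] -/
theorem deckHom_fE_apply_eq_self_iff (γ : 𝒢.graph.FundamentalGroup c₀) (e : 𝒢.graph.Edge)
    (p : 𝒢.graph.basept c₀ ⟶ 𝒢.graph.basept (Sum.inr e)) :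
    ((𝒢.deckHom h𝒢 c₀ γ).fE e).hom.hom p = p ↔ γ = 1 := by
  change inv γ ≫ p = p ↔ γ = 1
  constructor
  · intro hp
    have : inv γ = 𝟙 _ := by
      rw [← cancel_mono p, Category.id_comp]
      exact hp
    exact IsIso.inv_eq_inv.mp (this.trans IsIso.inv_id.symm)
  · rintro rfl
    change inv (𝟙 (𝒢.graph.basept c₀)) ≫ p = p
    rw [show inv (𝟙 (𝒢.graph.basept c₀)) = 𝟙 _ from IsIso.inv_id, Category.id_comp]

/-- The deck group acts transitively on the fibre over each edge.
[cite: MochizukiSemiAnbd2006, Prop 3.6 p.38] -/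
theorem exists_deckHom_fE_apply_eq (e : 𝒢.graph.Edge)
    (p q : 𝒢.graph.basept c₀ ⟶ 𝒢.graph.basept (Sum.inr e)) :
    ∃ γ : 𝒢.graph.FundamentalGroup c₀, ((𝒢.deckHom h𝒢 c₀ γ).fE e).hom.hom p = q := by
  refine ⟨p ≫ inv q, ?_⟩
  change inv (p ≫ inv q) ≫ p = q
  rw [IsIso.inv_comp, IsIso.inv_inv, Category.assoc, IsIso.inv_hom_id, Category.comp_id]

end ProfiniteSemiGraph

end Literature.AnabelianGeometry.SemiGraphs
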